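import Literature.AlgebraicGeometry.Hyperkaehler.K3HilbertType
import Literature.AlgebraicGeometry.HodgeTheory.ComplexGysinCorrespondence
import Literature.AlgebraicGeometry.HodgeTheory.RationalHodgeClasses
import Literature.AlgebraicGeometry.HodgeTheory.ChernCharacterBetti
import HarnessLib

/-!
# Beauville's marked incidence for the Hilbert square of a projective K3 surface — NAMED FACT

Layer `Literature/AlgebraicGeometry/Hyperkaehler`. Written by the line lead of crux stmt-HodgeConjecture-13674
(`NikulinTwinTransport.TwinSimilitudeAlgebraic`, line `hyperkaehler-nikulin-anchors`, fact F4 of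
`Cruxes/TwinSimilitudeAlgebraic/Lines/hyperkaehler_nikulin_anchors.lean` reshape r2); also what the
sibling cruxes 14393 (`mukai-lift-full-similitude`, stub `HilbertPackage`, `n = 2`) and 15067 consume.

Sources READ: A. Beauville, *Variétés kählériennes dont la première classe de Chern est nulle*,
J. Differential Geom. 18 (1983), §6 p. 765 (`S^{[r]}`), Prop. 6 (p. 768): "Soit `S` une surface K3, et
`r` un entier `≥ 2`. Alors `S^{[r]}` est simplement connexe, il existe un homomorphisme injectif
`i : H²(S, ℂ) → H²(S^{[r]}, ℂ)`, compatible aux structures de Hodge, et on a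
`H²(S^{[r]}, ℂ) = i(H²(S, ℂ)) ⊕ ℂ[E]`", with the Remarque "`H²(S^{[r]}, ℤ) = i(H²(S, ℤ)) ⊕ ℤδ`, où
`2δ = [E]`"; §9 Lemme 1 and Remarque 1 (p. 778): "Normalisons `q` de façon que `q(i(α)) = α²`; on peut
alors montrer qu'on a `q(e) = −8(r − 1)` […] cela entraîne que `q` est la polarisation canonique de
`H²(S^{[r]}, ℂ)`" (so `q(δ) = −2` for `r = 2`, `δ ⟂ i(H²(S))`), and Fujiki's relation `∫ α⁴ = 3 q(α)²` on
`S^{[2]}` (Beauville §9; Fujiki 1987); the map `i` is induced by the INCIDENCE correspondence — the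
universal family `Ξ ⊂ S × S^{[2]}` (`i([C]) = [{ξ : supp ξ ∩ C ≠ ∅}] = pr_{2*}(pr_1^*[C] · [Ξ])`);
Grothendieck (existence and projectivity of `S^{[2]}`, Nitsure Thm. 5.1) and Fogarty (smoothness,
Beauville §6 (b)); definitions against which this is stated: `HilbertScheme.IsHilbertSchemeOfPoints`,
`Hyperkaehler.IsOfK3HilbertType` / `IsOfK3HilbertSquareType`, `K3HilbertIndex`, `k3HilbertForm`
(file `K3HilbertType`, whose "Not here" lists exactly this theorem).

Rendering (tree carriers): for a marked projective K3 surface `(S, η, p, x)` (the six marking clauses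
of `Surfaces.Huybrechts_K3_marking_exists`, `MarkedK3[S, η, p, x]`) with projective period clauses and
an orientation family `μ` with Poincaré duality, there are a Hilbert square `(H, Ξ)` of `S`
(`IsHilbertSchemeOfPoints 2 S H Ξ`) which is smooth projective of dimension `4` and of `K3^{[2]}`-type,
a Beauville–Bogomolov marking `(φ_H, P_H)` of `H` with period `(x, 0)` (the clauses `MarkedK3Sq`,
verbatim those of `SymplecticInvolutionK3Square` / `MarkmanRationalHodgeIsometries`: integral
generator `P_H` of `H⁸`, integral marking `φ_H : H²(H(ℂ); ℂ) ≅ (Λ_{K3} ⊕ ⟨−2⟩) ⊗ ℂ`, Fujiki relation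
with constant `3`, `φ_H⁻¹(x, 0)` spans `H^{2,0}`, `H^{1,1} = ⟨(x,0), (x̄,0)⟩^{⊥_q}`, period
inequalities), and an ALGEBRAIC class `θ ∈ N²H⁴((H ⊗ S)(ℂ); ℂ)` (the class of `Ξ`, up to the unit by
which `μ` differs from the complex orientations) whose action `[θ]_* = pr_{H*}(pr_S^* – ∪ θ)`
(`HodgeTheory.corrAction μ`) is Beauville's `i` in the markings: `φ_H([θ]_* a) = (η a, 0)`.

What is NOT here: `r ≥ 3`; the isolated statement `b₂ = 23` (`K3HilbertSchemeBeauville`); the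
description of `δ` as half the exceptional divisor; any proof.
-/

noncomputable section

open CategoryTheory MonoidalCategory
open Literature.AlgebraicTopology.SingularHomology

namespace Literature.AlgebraicGeometry.Hyperkaehler

/-- `MarkedK3[S, η, p, x]`: the six K3 marking clauses, VERBATIM those of
`Surfaces.Huybrechts_K3_marking_exists`. Local notation only. [cite: Huybrechts2016K3, Ch. 1 Prop. 3.5] -/
local notation3 (prettyPrint := false) "MarkedK3[" S ", " η ", " p ", " x "]" =>
  (HodgeTheory.IsIntegralClass p ∧
    (∀ q : HodgeTheory.complexBetti S (2 * 2), HodgeTheory.IsIntegralClass q → ∃ n : ℤ, q = n • p) ∧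
    (∀ c : HodgeTheory.complexBetti S (2 * 1),
        HodgeTheory.IsIntegralClass c ↔ ∃ v : Surfaces.K3Index → ℤ, η c = fun i => (v i : ℂ)) ∧
    (∀ a b : HodgeTheory.complexBetti S (2 * 1),
        cupProduct (rfl : 2 * 1 + 2 * 1 = 2 * 2) a b = Surfaces.k3Form (η a) (η b) • p) ∧
    HodgeTheory.IsOfHodgeType 2 S (2 * 1) 2 0 (LinearEquiv.symm η x) ∧
    (∀ τ : HodgeTheory.complexBetti S (2 * 1),
        HodgeTheory.IsOfHodgeType 2 S (2 * 1) 2 0 τ → ∃ t : ℂ, τ = t • LinearEquiv.symm η x))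

/-- `MarkedK3Sq[X, φ, P, z]`: a BEAUVILLE–BOGOMOLOV MARKING of a smooth projective fourfold `X` of
`K3^{[2]}`-type with period `z ∈ (Λ_{K3} ⊕ ⟨−2⟩) ⊗ ℂ` (verbatim the clauses of
`SymplecticInvolutionK3Square` / `MarkmanRationalHodgeIsometries`): (m1) `P` is an integral generator of `H⁸(X(ℂ); ℂ)`; (m2) `φ`
identifies the integral classes of `H²(X(ℂ); ℂ)` with `ℤ²³`; (m3) Fujiki relation
`a⁴ = 3 · q(φ a)² · P`, `q = k3HilbertForm 2` (it pins `q ∘ φ` to the Beauville–Bogomolov form and `P`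
to the complex orientation class); (m4) `φ⁻¹ z` spans the `(2,0)`-classes; (m5) the `(1,1)`-classes are
the `q`-orthogonal of `z` and `z̄`; (m6) `q(z) = 0 < q(z̄, z)`. Local notation only.
[cite: Beauville1983, §8 Thm. 5 and §9 Lemme 1, Rem. 1] [cite: Huybrechts1999, §1.9 and §1.11] -/
local notation3 (prettyPrint := false) "MarkedK3Sq[" X ", " φ ", " P ", " z "]" =>
  ((HodgeTheory.IsIntegralClass P ∧
      ∀ Q : HodgeTheory.complexBetti X (2 * 4), HodgeTheory.IsIntegralClass Q → ∃ n : ℤ, Q = n • P) ∧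
    (∀ c : HodgeTheory.complexBetti X 2,
        HodgeTheory.IsIntegralClass c ↔ ∃ v : K3HilbertIndex → ℤ, φ c = fun i => (v i : ℂ)) ∧
    (∀ a : HodgeTheory.complexBetti X 2,
        HodgeTheory.cupPowTwo a 4 = ((3 : ℂ) * (k3HilbertForm 2 (φ a) (φ a)) ^ 2) • P) ∧
    (HodgeTheory.IsOfHodgeType 4 X 2 2 0 (LinearEquiv.symm φ z) ∧
      ∀ τ : HodgeTheory.complexBetti X 2, HodgeTheory.IsOfHodgeType 4 X 2 2 0 τ →
        ∃ t : ℂ, τ = t • LinearEquiv.symm φ z) ∧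
    (∀ c : HodgeTheory.complexBetti X 2, HodgeTheory.IsOfHodgeType 4 X 2 1 1 c ↔
        (k3HilbertForm 2 (φ c) z = 0 ∧ k3HilbertForm 2 (φ c) (star z) = 0)) ∧
    (k3HilbertForm 2 z z = 0 ∧ 0 < (k3HilbertForm 2 (star z) z).re))

/-- **F4 — BEAUVILLE'S MARKED INCIDENCE FOR THE HILBERT SQUARE OF A PROJECTIVE K3 SURFACE.**  Beauville
1983 §6 Prop. 6: "Soit `S` une surface K3, et `r ≥ 2`. Alors `S^{[r]}` est simplement connexe, il existe
un homomorphisme injectif `i : H²(S, ℂ) → H²(S^{[r]}, ℂ)`, compatible aux structures de Hodge, et on a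
`H²(S^{[r]}, ℂ) = i(H²(S, ℂ)) ⊕ ℂ[E]`", Remarque: "`H²(S^{[r]}, ℤ) = i(H²(S, ℤ)) ⊕ ℤδ`", §9 Lemme 1 and
Rem. 1: "`q(i(α)) = α²` […] `q(δ) = −2(r − 1)` […] `q` est la polarisation canonique" with Fujiki's
relation `∫ α⁴ = 3 q(α)²` for `r = 2`; `i` is induced by the INCIDENCE correspondence `Ξ ⊂ S × S^{[2]}`
(the universal family: `i([C]) = [{ξ : supp ξ ∩ C ≠ ∅}]`), Grothendieck/Fogarty: `S^{[2]}` exists and is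
smooth projective of dimension `4`.  Rendering: for a marked projective K3 `(S, η, p, x)` with projective
period clauses and every orientation family with Poincaré duality there are a Hilbert square
`(H, Ξ)` of `S` (`IsHilbertSchemeOfPoints 2 S H Ξ`), smooth projective of dimension `4` and of
`K3^{[2]}`-type, a BBF-marking `(φ_H, P_H)` of `H` of period `(x, 0)`, and an ALGEBRAIC class
`θ ∈ N²H⁴((H ⊗ S)(ℂ); ℂ)` whose action `[θ]_* : H²(S) → H²(H)` is the marked inclusion
`φ_H([θ]_* a) = (η a, 0)`.
[cite: Beauville1983, §6 Prop. 6 and Remarque, §9 Lemme 1 and Rem. 1] [cite: Nitsure2005, Thm. 5.1] -/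
def Beauville1983_hilbertSquare_markedIncidence : Prop :=
  ∀ (μ : HodgeTheory.OrientationFamily), μ.HasPoincareDuality →
    ∀ (S : Motives.SchemeOver ℂ) (hS : Surfaces.IsK3Surface S)
      (η : HodgeTheory.complexBetti S (2 * 1) ≃ₗ[ℂ] (Surfaces.K3Index → ℂ))
      (p : HodgeTheory.complexBetti S (2 * 2)) (x : Surfaces.K3Index → ℂ),
      MarkedK3[S, η, p, x] →
      Surfaces.k3Form x x = 0 → 0 < (Surfaces.k3Form (star x) x).re →
      (∃ u : Surfaces.K3Index → ℤ, Surfaces.k3Form (fun i => (u i : ℂ)) x = 0 ∧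
          0 < ∑ i, ∑ j, u i * Surfaces.k3Gram i j * u j) →
      ∃ (H : Motives.SchemeOver ℂ) (hH : Motives.IsSmoothProjective 4 H)
        (Ξ : (S ⊗ H).left.IdealSheafData)
        (φH : HodgeTheory.complexBetti H 2 ≃ₗ[ℂ] (K3HilbertIndex → ℂ))
        (PH : HodgeTheory.complexBetti H (2 * 4)),
        HilbertScheme.IsHilbertSchemeOfPoints 2 S H Ξ ∧ IsOfK3HilbertSquareType H ∧
        MarkedK3Sq[H, φH, PH, Sum.elim x 0] ∧
        ∃ θ ∈ HodgeTheory.algebraicClasses (H ⊗ S) 2,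
          ∀ a : HodgeTheory.complexBetti S (2 * 1),
            φH (HodgeTheory.corrAction μ hH (Surfaces.IsK3Surface.isSmoothProjective hS)
              (rfl : 2 * 1 + 2 * 2 = 2 + 2 * 2) θ a) = Sum.elim (η a) 0

end Literature.AlgebraicGeometry.Hyperkaehler

end
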